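import Summits.CriticalPhenomena.PercolationContinuityZ3.Theorems.PercNearOneGluingNoHeavyLowerTailTformPriorityChain
import HarnessLib

/-!
# `NoHeavyLowerTail` (stmt-CriticalPhenomena-4575) — the crux reduced to GLUE-CHAMP: gluing for CHAMPION witnesses of LIGHT members only

Support file (prover `prim-hp-5`, hull-port cell, T-form calculus, gen 6; `--supports stmt-CriticalPhenomena-4575`).
No definitions, no named facts, no sorries.

`Theorems.noHeavyLowerTail_of_gluedWitness₂` (file `…TformGluedWitness`) reduces the crux to GLUE-ADM — a relay `x` that is a
T-witness of every member of a non-relay set `B` is a T-witness of the glued set — for EVERY relay `x`.  On 2026-08-19 the census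
(ttrl2, `run/shared/lean/ttrl/tcs/glueadm_climbs/GLUEADM_MAIN_witness_1.json`) found an exact counterexample to that schema at
`n = 9`, `|A| = 5`, `j = 2` (margin `−1.3·10⁻⁷`): the failing `x` is NOT a champion of the graph (it is near-glued to another relay),
while for the champion the glued inequality holds there with margin `+4·10⁻⁵`.  The open-recursion induction only ever applies the
gluing step to the CHAMPION `q` of `u = G − o` and to members `y` that are LIGHTER than `q` (`Φ_u(q) < μ_u(N_y ≤ j)`); this file
re-derives the reduction with exactly these two restrictions added to the hypothesis, so that the typed target is again one with
no known counterexample (ttrl2 LSP / TPS-champion census: 0 violations):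

* `lightMultiStarPacking_open_of_gluedChampion`, `noHeavyLowerTail_of_gluedChampion` — crux ⟸ GLUE-CHAMP:
  for every graph, relays `A`, non-relay `B` (`2 ≤ |B|`), CHAMPION `x` (`Φ(a) ≤ Φ(x)` for all `a ∈ A`) with every member light
  (`Φ(x) < μ(N_y ≤ j)`) and `x` a T-witness of every member: `x` is a T-witness of the glued set;
* `noHeavyLowerTail_of_championPriorityChains` — the same with the glued-set inequality replaced by the priority-chain inequality of
  `…TformPriorityChain` (first attached member light), via `gluedSet_of_priorityChain`.
-/

noncomputable section

namespace Summit.CriticalPhenomena.PercolationContinuityZ3.Theorems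

open MeasureTheory Set Literature.Probability.LatticeModels Literature.Probability.Percolation
open scoped Classical BigOperators

/-- **Glued CHAMPION witnesses of LIGHT multi-stars discharge the light multi-star packing hypothesis of the open-recursion
induction** — `lightMultiStarPacking_open_of_gluedWitness₂` with the gluing hypothesis restricted to `x` a champion of the
graph (`Φ(a) ≤ Φ(x)` for all relays `a`) and to members lighter than `x` (`Φ(x) < μ(N_y ≤ j)`), which is all the induction uses.
[cite: KozmaNitzan2024, Lemma 5 (p. 13)] -/
theorem lightMultiStarPacking_open_of_gluedChampion
    (hGlue : ∀ (n : ℕ) (u : Sym2 (Fin n) → unitInterval) (A B : Finset (Fin n)) (x : Fin n) (j : ℕ),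
      x ∈ A → (∀ y ∈ B, y ∉ A) → 2 ≤ B.card →
      (∀ a ∈ A, (prodBernoulli u).real {ω : BondConfig (Fin n) | (A.filter fun z => ω ∈ openConn a z).card ≤ j} ≤
        (prodBernoulli u).real {ω : BondConfig (Fin n) | (A.filter fun z => ω ∈ openConn x z).card ≤ j}) →
      (∀ y ∈ B, (prodBernoulli u).real {ω : BondConfig (Fin n) | (A.filter fun z => ω ∈ openConn x z).card ≤ j} <
        (prodBernoulli u).real {ω : BondConfig (Fin n) | (A.filter fun z => ω ∈ openConn y z).card ≤ j}) →
      (∀ y ∈ B, ∀ c ∈ A,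
        (prodBernoulli u).real {ω : BondConfig (Fin n) |
            1 ≤ (A.filter fun z => ω ∈ openConn y z).card ∧ (A.filter fun z => ω ∈ openConn y z).card ≤ j} +
          (prodBernoulli u).real {ω : BondConfig (Fin n) | (A.filter fun z => ω ∈ openConn c z).card ≤ j} ≤
        (prodBernoulli u).real {ω : BondConfig (Fin n) |
            (A.filter fun z => ω ∈ openConn c z).card ≤ j ∧ 1 ≤ (A.filter fun z => ω ∈ openConn y z).card} +
          (prodBernoulli u).real {ω : BondConfig (Fin n) | (A.filter fun z => ω ∈ openConn x z).card ≤ j}) →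
      ∀ c ∈ A,
        (prodBernoulli u).real {ω : BondConfig (Fin n) |
            (∀ y ∈ B, ω ∉ openConn x y) ∧
              1 ≤ (A.filter fun z => ∃ y ∈ B, ω ∈ openConn y z).card ∧
              (A.filter fun z => ∃ y ∈ B, ω ∈ openConn y z).card ≤ j} +
          (prodBernoulli u).real {ω : BondConfig (Fin n) |
            ¬ 1 ≤ (A.filter fun z => ∃ y ∈ B, ω ∈ openConn y z).card ∧
              (A.filter fun z => ω ∈ openConn c z).card ≤ j} ≤
        (prodBernoulli u).real {ω : BondConfig (Fin n) |
            (∀ y ∈ B, ω ∉ openConn x y) ∧ (A.filter fun z => ω ∈ openConn x z).card ≤ j}) :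
    ∀ (n : ℕ) (w : Sym2 (Fin n) → unitInterval) (A B : Finset (Fin n)) (o q c : Fin n) (j : ℕ),
      (∀ (n' : ℕ) (w' : Sym2 (Fin n') → unitInterval) (A' : Finset (Fin n')) (o' q' c' : Fin n') (j' : ℕ),
        (Finset.univ.filter fun e : Sym2 (Fin n') => w' e ≠ 0).card <
          (Finset.univ.filter fun e : Sym2 (Fin n) => w e ≠ 0).card →
        o' ∉ A' → q' ∈ A' → c' ∈ A' →
        (∀ a ∈ A', (prodBernoulli w').real {ω : BondConfig (Fin n') | (A'.filter fun x => ω ∈ openConn a x).card ≤ j'} ≤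
          (prodBernoulli w').real {ω : BondConfig (Fin n') | (A'.filter fun x => ω ∈ openConn q' x).card ≤ j'}) →
        (prodBernoulli w').real {ω : BondConfig (Fin n') |
            1 ≤ (A'.filter fun x => ω ∈ openConn o' x).card ∧ (A'.filter fun x => ω ∈ openConn o' x).card ≤ j'} +
          (prodBernoulli w').real {ω : BondConfig (Fin n') | (A'.filter fun x => ω ∈ openConn c' x).card ≤ j'} ≤
        (prodBernoulli w').real {ω : BondConfig (Fin n') |
            (A'.filter fun x => ω ∈ openConn c' x).card ≤ j' ∧ 1 ≤ (A'.filter fun x => ω ∈ openConn o' x).card} +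
          (prodBernoulli w').real {ω : BondConfig (Fin n') | (A'.filter fun x => ω ∈ openConn q' x).card ≤ j'}) →
      o ∉ A → q ∈ A → c ∈ A → 2 ≤ B.card → (∀ y ∈ B, y ∉ A ∧ y ≠ o ∧ w s(o, y) ≠ 0) →
      (∀ a ∈ A, (prodBernoulli fun e => if e ∈ {e : Sym2 (Fin n) | o ∉ e} then w e else 0).real
          {ξ : BondConfig (Fin n) | (A.filter fun z => (openGraph ξ).Reachable a z).card ≤ j} ≤
        (prodBernoulli fun e => if e ∈ {e : Sym2 (Fin n) | o ∉ e} then w e else 0).real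
          {ξ : BondConfig (Fin n) | (A.filter fun z => (openGraph ξ).Reachable q z).card ≤ j}) →
      (∀ y ∈ B, (prodBernoulli fun e => if e ∈ {e : Sym2 (Fin n) | o ∉ e} then w e else 0).real
          {ξ : BondConfig (Fin n) | (A.filter fun z => (openGraph ξ).Reachable q z).card ≤ j} <
        (prodBernoulli fun e => if e ∈ {e : Sym2 (Fin n) | o ∉ e} then w e else 0).real
          {ξ : BondConfig (Fin n) | (A.filter fun z => (openGraph ξ).Reachable y z).card ≤ j}) →
      (prodBernoulli fun e => if e ∈ {e : Sym2 (Fin n) | o ∉ e} then w e else 0).real {ξ : BondConfig (Fin n) |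
          (∀ y ∈ B, ¬ (openGraph ξ).Reachable q y) ∧
            1 ≤ (A.filter fun z => ∃ y ∈ B, (openGraph ξ).Reachable y z).card ∧
            (A.filter fun z => ∃ y ∈ B, (openGraph ξ).Reachable y z).card ≤ j} +
        (prodBernoulli fun e => if e ∈ {e : Sym2 (Fin n) | o ∉ e} then w e else 0).real {ξ : BondConfig (Fin n) |
          ¬ 1 ≤ (A.filter fun z => ∃ y ∈ B, (openGraph ξ).Reachable y z).card ∧
            (A.filter fun z => (openGraph ξ).Reachable c z).card ≤ j} ≤
      (prodBernoulli fun e => if e ∈ {e : Sym2 (Fin n) | o ∉ e} then w e else 0).real {ξ : BondConfig (Fin n) |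
          (∀ y ∈ B, ¬ (openGraph ξ).Reachable q y) ∧ (A.filter fun z => (openGraph ξ).Reachable q z).card ≤ j} := by
  intro n w A B o q c j ih ho hq hc hB hBy hch hl
  set u : Sym2 (Fin n) → unitInterval := fun e => if e ∈ {e : Sym2 (Fin n) | o ∉ e} then w e else 0 with hu
  -- `u` has fewer positive pairs than `w`: the pair `s(o, y₀)` (`y₀ ∈ B`) is positive for `w` and zero for `u`
  obtain ⟨y₀, hy₀⟩ : B.Nonempty := Finset.card_pos.1 (by omega)
  have hlt : (Finset.univ.filter fun e : Sym2 (Fin n) => u e ≠ 0).card <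
      (Finset.univ.filter fun e : Sym2 (Fin n) => w e ≠ 0).card := by
    refine Finset.card_lt_card ⟨fun e he => ?_, fun hsub => ?_⟩
    · rw [Finset.mem_filter] at he ⊢
      refine ⟨he.1, fun hwe => he.2 ?_⟩
      simp only [hu, mem_setOf_eq]
      split_ifs <;> simp [hwe]
    · have hmem : s(o, y₀) ∈ (Finset.univ.filter fun e : Sym2 (Fin n) => w e ≠ 0) :=
        Finset.mem_filter.2 ⟨Finset.mem_univ _, (hBy y₀ hy₀).2.2⟩
      have := Finset.mem_filter.1 (hsub hmem)
      apply this.2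
      simp only [hu, mem_setOf_eq, Sym2.mem_iff, true_or, not_true_eq_false, if_false]
  -- dictionary `(openGraph ξ).Reachable` ↔ `ξ ∈ openConn`
  have hfilt : ∀ (x : Fin n) (ξ : BondConfig (Fin n)),
      (A.filter fun z => (openGraph ξ).Reachable x z) = (A.filter fun z => ξ ∈ openConn x z) :=
    fun x ξ => Finset.filter_congr fun _ _ => Iff.rfl
  have hfiltB : ∀ (ξ : BondConfig (Fin n)),
      (A.filter fun z => ∃ y ∈ B, (openGraph ξ).Reachable y z) = (A.filter fun z => ∃ y ∈ B, ξ ∈ openConn y z) :=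
    fun ξ => Finset.filter_congr fun _ _ => Iff.rfl
  have eoc : ∀ (x : Fin n), {ξ : BondConfig (Fin n) | (A.filter fun z => (openGraph ξ).Reachable x z).card ≤ j} =
      {ξ : BondConfig (Fin n) | (A.filter fun z => ξ ∈ openConn x z).card ≤ j} := by
    intro x; ext ξ; simp only [mem_setOf_eq, hfilt x ξ]
  -- the champion hypothesis in `openConn` form
  have hch' : ∀ a ∈ A, (prodBernoulli u).real {ξ : BondConfig (Fin n) | (A.filter fun z => ξ ∈ openConn a z).card ≤ j} ≤
      (prodBernoulli u).real {ξ : BondConfig (Fin n) | (A.filter fun z => ξ ∈ openConn q z).card ≤ j} := by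
    intro a ha; rw [← eoc a, ← eoc q]; exact hch a ha
  -- the induction hypothesis: `q` is a T-witness for every member of `B` (an observer of `u`)
  have hW : ∀ y ∈ B, ∀ c' ∈ A,
      (prodBernoulli u).real {ω : BondConfig (Fin n) |
          1 ≤ (A.filter fun z => ω ∈ openConn y z).card ∧ (A.filter fun z => ω ∈ openConn y z).card ≤ j} +
        (prodBernoulli u).real {ω : BondConfig (Fin n) | (A.filter fun z => ω ∈ openConn c' z).card ≤ j} ≤
      (prodBernoulli u).real {ω : BondConfig (Fin n) |
          (A.filter fun z => ω ∈ openConn c' z).card ≤ j ∧ 1 ≤ (A.filter fun z => ω ∈ openConn y z).card} +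
        (prodBernoulli u).real {ω : BondConfig (Fin n) | (A.filter fun z => ω ∈ openConn q z).card ≤ j} :=
    fun y hy c' hc' => ih n u A y q c' j hlt (hBy y hy).1 hq hc' hch'
  -- glue
  -- the members are lighter than the champion (in `openConn` form)
  have hl' : ∀ y ∈ B, (prodBernoulli u).real {ξ : BondConfig (Fin n) | (A.filter fun z => ξ ∈ openConn q z).card ≤ j} <
      (prodBernoulli u).real {ξ : BondConfig (Fin n) | (A.filter fun z => ξ ∈ openConn y z).card ≤ j} := by
    intro y hy; rw [← eoc q, ← eoc y]; exact hl y hy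
  have key := hGlue n u A B q j hq (fun y hy => (hBy y hy).1) hB hch' hl' hW c hc
  -- back to `Reachable` form
  have e1 : {ω : BondConfig (Fin n) | (∀ y ∈ B, ω ∉ openConn q y) ∧
        1 ≤ (A.filter fun z => ∃ y ∈ B, ω ∈ openConn y z).card ∧
        (A.filter fun z => ∃ y ∈ B, ω ∈ openConn y z).card ≤ j} =
      {ξ : BondConfig (Fin n) | (∀ y ∈ B, ¬ (openGraph ξ).Reachable q y) ∧
        1 ≤ (A.filter fun z => ∃ y ∈ B, (openGraph ξ).Reachable y z).card ∧
        (A.filter fun z => ∃ y ∈ B, (openGraph ξ).Reachable y z).card ≤ j} := by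
    ext ξ; simp only [mem_setOf_eq, hfiltB ξ]; exact Iff.rfl
  have e2 : {ω : BondConfig (Fin n) | ¬ 1 ≤ (A.filter fun z => ∃ y ∈ B, ω ∈ openConn y z).card ∧
        (A.filter fun z => ω ∈ openConn c z).card ≤ j} =
      {ξ : BondConfig (Fin n) | ¬ 1 ≤ (A.filter fun z => ∃ y ∈ B, (openGraph ξ).Reachable y z).card ∧
        (A.filter fun z => (openGraph ξ).Reachable c z).card ≤ j} := by
    ext ξ; simp only [mem_setOf_eq, hfiltB ξ, hfilt c ξ]
  have e3 : {ω : BondConfig (Fin n) | (∀ y ∈ B, ω ∉ openConn q y) ∧ (A.filter fun z => ω ∈ openConn q z).card ≤ j} =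
      {ξ : BondConfig (Fin n) | (∀ y ∈ B, ¬ (openGraph ξ).Reachable q y) ∧
        (A.filter fun z => (openGraph ξ).Reachable q z).card ≤ j} := by
    ext ξ; simp only [mem_setOf_eq, hfilt q ξ]; exact Iff.rfl
  rw [e1, e2, e3] at key
  exact key


/-- **The crux from GLUE-CHAMP** (gluing for champion witnesses of light members): corrected form of
`noHeavyLowerTail_of_gluedWitness₂` after the census counterexample to the unrestricted gluing schema.
[cite: KozmaNitzan2024, Lemma 5 (p. 13)] -/
theorem noHeavyLowerTail_of_gluedChampion
    (hGlue : ∀ (n : ℕ) (u : Sym2 (Fin n) → unitInterval) (A B : Finset (Fin n)) (x : Fin n) (j : ℕ),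
      x ∈ A → (∀ y ∈ B, y ∉ A) → 2 ≤ B.card →
      (∀ a ∈ A, (prodBernoulli u).real {ω : BondConfig (Fin n) | (A.filter fun z => ω ∈ openConn a z).card ≤ j} ≤
        (prodBernoulli u).real {ω : BondConfig (Fin n) | (A.filter fun z => ω ∈ openConn x z).card ≤ j}) →
      (∀ y ∈ B, (prodBernoulli u).real {ω : BondConfig (Fin n) | (A.filter fun z => ω ∈ openConn x z).card ≤ j} <
        (prodBernoulli u).real {ω : BondConfig (Fin n) | (A.filter fun z => ω ∈ openConn y z).card ≤ j}) →
      (∀ y ∈ B, ∀ c ∈ A,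
        (prodBernoulli u).real {ω : BondConfig (Fin n) |
            1 ≤ (A.filter fun z => ω ∈ openConn y z).card ∧ (A.filter fun z => ω ∈ openConn y z).card ≤ j} +
          (prodBernoulli u).real {ω : BondConfig (Fin n) | (A.filter fun z => ω ∈ openConn c z).card ≤ j} ≤
        (prodBernoulli u).real {ω : BondConfig (Fin n) |
            (A.filter fun z => ω ∈ openConn c z).card ≤ j ∧ 1 ≤ (A.filter fun z => ω ∈ openConn y z).card} +
          (prodBernoulli u).real {ω : BondConfig (Fin n) | (A.filter fun z => ω ∈ openConn x z).card ≤ j}) →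
      ∀ c ∈ A,
        (prodBernoulli u).real {ω : BondConfig (Fin n) |
            (∀ y ∈ B, ω ∉ openConn x y) ∧
              1 ≤ (A.filter fun z => ∃ y ∈ B, ω ∈ openConn y z).card ∧
              (A.filter fun z => ∃ y ∈ B, ω ∈ openConn y z).card ≤ j} +
          (prodBernoulli u).real {ω : BondConfig (Fin n) |
            ¬ 1 ≤ (A.filter fun z => ∃ y ∈ B, ω ∈ openConn y z).card ∧
              (A.filter fun z => ω ∈ openConn c z).card ≤ j} ≤
        (prodBernoulli u).real {ω : BondConfig (Fin n) |
            (∀ y ∈ B, ω ∉ openConn x y) ∧ (A.filter fun z => ω ∈ openConn x z).card ≤ j}) :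
    Summit.CriticalPhenomena.PercolationContinuityZ3.Theses.PercNearOneGluing.NoHeavyLowerTail :=
  noHeavyLowerTail_of_attachedChampion fun n w A o q j ho hq hchamp =>
    attachedChampion_of_lightMultiStarPacking_open (lightMultiStarPacking_open_of_gluedChampion hGlue) n w A o q j ho hq hchamp

/-- **The crux from champion priority chains**: as `noHeavyLowerTail_of_priorityChains`, with the chain inequality required only for
CHAMPIONS `x` and LIGHT members. [cite: KozmaNitzan2024, §3.2 (pp. 12–14)] -/
theorem noHeavyLowerTail_of_championPriorityChains
    (hPC : ∀ (n : ℕ) (u : Sym2 (Fin n) → unitInterval) (A B : Finset (Fin n)) (x : Fin n) (j : ℕ),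
      x ∈ A → (∀ y ∈ B, y ∉ A) → 2 ≤ B.card →
      (∀ a ∈ A, (prodBernoulli u).real {ω : BondConfig (Fin n) | (A.filter fun z => ω ∈ openConn a z).card ≤ j} ≤
        (prodBernoulli u).real {ω : BondConfig (Fin n) | (A.filter fun z => ω ∈ openConn x z).card ≤ j}) →
      (∀ y ∈ B, (prodBernoulli u).real {ω : BondConfig (Fin n) | (A.filter fun z => ω ∈ openConn x z).card ≤ j} <
        (prodBernoulli u).real {ω : BondConfig (Fin n) | (A.filter fun z => ω ∈ openConn y z).card ≤ j}) →
      (∀ y ∈ B, ∀ c ∈ A,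
        (prodBernoulli u).real {ω : BondConfig (Fin n) |
            1 ≤ (A.filter fun z => ω ∈ openConn y z).card ∧ (A.filter fun z => ω ∈ openConn y z).card ≤ j} +
          (prodBernoulli u).real {ω : BondConfig (Fin n) | (A.filter fun z => ω ∈ openConn c z).card ≤ j} ≤
        (prodBernoulli u).real {ω : BondConfig (Fin n) |
            (A.filter fun z => ω ∈ openConn c z).card ≤ j ∧ 1 ≤ (A.filter fun z => ω ∈ openConn y z).card} +
          (prodBernoulli u).real {ω : BondConfig (Fin n) | (A.filter fun z => ω ∈ openConn x z).card ≤ j}) →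
      ∀ c ∈ A,
        ∑ y ∈ B, (prodBernoulli u).real {ω : BondConfig (Fin n) |
            (∀ y' ∈ B, ω ∉ openConn x y') ∧
              (∀ y' ∈ B, y' < y → ¬ 1 ≤ (A.filter fun z => ω ∈ openConn y' z).card) ∧
              1 ≤ (A.filter fun z => ω ∈ openConn y z).card ∧ (A.filter fun z => ω ∈ openConn y z).card ≤ j} +
          (prodBernoulli u).real {ω : BondConfig (Fin n) |
            ¬ 1 ≤ (A.filter fun z => ∃ y ∈ B, ω ∈ openConn y z).card ∧
              (A.filter fun z => ω ∈ openConn c z).card ≤ j} ≤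
        (prodBernoulli u).real {ω : BondConfig (Fin n) |
            (∀ y ∈ B, ω ∉ openConn x y) ∧ (A.filter fun z => ω ∈ openConn x z).card ≤ j}) :
    Summit.CriticalPhenomena.PercolationContinuityZ3.Theses.PercNearOneGluing.NoHeavyLowerTail :=
  noHeavyLowerTail_of_gluedChampion fun n u A B x j hx hB hcard hch hl hW c hc =>
    gluedSet_of_priorityChain n u A B x c j (hPC n u A B x j hx hB hcard hch hl hW c hc)

end Summit.CriticalPhenomena.PercolationContinuityZ3.Theorems

end
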